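import Mathlib.RingTheory.Localization.Away.Basic
import Mathlib.RingTheory.Ideal.Operations
import Mathlib.RingTheory.Adjoin.Basic
import HarnessLib

/-!
# Crux `TeissierReduction` (stmt-ResolutionOfSingularities-17085, route `TeissierJung`):
# the coefficients of the strict transform lie in the affine blow-up algebra

Idea card `transversal-strict-transform`. Let `A` be a commutative ring, `I ⊆ A` an ideal and
`t ∈ I`. The affine blow-up algebra `A[I/t] ⊆ A[1/t]` is the `A`-subalgebra of the localization
`A[1/t]` generated by the fractions `b/t`, `b ∈ I`. If a monic polynomial
`f = zⁿ + Σ_{i<n} aᵢ zⁱ ∈ A[z]` is *equimultiple along `V(I)`* for the projection `z`, i.e.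
`aᵢ ∈ I^{n-i}` for all `i < n`, then `z/t` satisfies the monic equation
`(z/t)ⁿ + Σ (aᵢ/t^{n-i}) (z/t)ⁱ = 0`, whose coefficients `aᵢ / t^{n-i}` lie in `A[I/t]`; so `z/t`
is integral over `A[I/t]` (the strict transform of `V(f)` is finite over the blow-up chart of the
base). This file proves exactly the coefficient membership:

* `mk'_mem_adjoin_of_mem_pow` — `x ∈ I^N ⇒ x/t^N ∈ A[I/t]` (Stacks 052Q: every element of
  `A[I/t]` "can be represented by an expression of the form `x/tⁿ` with `x ∈ Iⁿ`"; here the easy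
  converse direction), by induction on `N` (`I^{N+1} = I^N · I`, `(s b)/t^{N+1} = (s/t^N)(b/t)`);
* `stub_strictTransformIntegral` — the registered stub: `aᵢ / t^{n-i} ∈ A[I/t]` for all `i`.

The same membership, for the generators written as `x · (1/t)` instead of `IsLocalization.mk'`,
is `Literature.AlgebraicGeometry.Resolution.algebraMap_mul_invSelf_pow_mem_blowupAlgebra`
(`AffineBlowupAlgebra.lean`); the present `mk'`-form is self-contained (three Mathlib imports).
-/

-- single-problem summit: the doubled namespace component `ResolutionOfSingularities` is forced
set_option linter.dupNamespace false

namespace Summit.ResolutionOfSingularities.ResolutionOfSingularities.Theorems.TeissierReduction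

section

/-- **`x/t^N ∈ A[I/t]` for `x ∈ I^N`**: the fraction `x / t^N` of the localization `A[1/t]`
lies in the `A`-subalgebra generated by the `b/t`, `b ∈ I`, whenever `x ∈ I^N`. Induction on
`N`: for `N = 0` it is `x/1 = x ∈ A`; for `N + 1`, `I^{N+1} = I^N · I` is additively generated
by the products `s · b`, `s ∈ I^N`, `b ∈ I`, and `(s b)/t^{N+1} = (s/t^N) · (b/t)`. [folklore] -/
theorem mk'_mem_adjoin_of_mem_pow (A : Type) [CommRing A] (I : Ideal A) (t : A) :
    ∀ (N : ℕ) (x : A), x ∈ I ^ N →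
      IsLocalization.mk' (Localization.Away t) x
          ⟨t ^ N, Submonoid.pow_mem _ (Submonoid.mem_powers t) _⟩ ∈
        Algebra.adjoin A
          {y : Localization.Away t | ∃ b ∈ I, y = IsLocalization.mk' (Localization.Away t) b
            ⟨t, Submonoid.mem_powers t⟩}
  | 0, x, _ => by
    -- adapted from Literature.AlgebraicGeometry.Resolution.AffineBlowupAlgebra
    --   (`algebraMap_mul_invSelf_pow_mem_blowupAlgebra`, the `x · (1/t)^N` form)
    have h1 : (⟨t ^ 0, Submonoid.pow_mem _ (Submonoid.mem_powers t) _⟩ : Submonoid.powers t) =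
        1 :=
      Subtype.ext (pow_zero t)
    rw [h1, IsLocalization.mk'_one]
    exact Subalgebra.algebraMap_mem _ x
  | N + 1, x, hx => by
    have hs : (⟨t ^ (N + 1), Submonoid.pow_mem _ (Submonoid.mem_powers t) _⟩ :
          Submonoid.powers t) =
        ⟨t ^ N, Submonoid.pow_mem _ (Submonoid.mem_powers t) _⟩ * ⟨t, Submonoid.mem_powers t⟩ :=
      Subtype.ext (pow_succ t N)
    rw [hs]
    rw [pow_succ] at hx
    refine Submodule.mul_induction_on hx (fun s hs b hb => ?_) (fun y z hy hz => ?_)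
    · -- `(s b)/(t^N t) = (s/t^N) (b/t)`, a member times a generator
      rw [IsLocalization.mk'_mul]
      exact Subalgebra.mul_mem _ (mk'_mem_adjoin_of_mem_pow A I t N s hs)
        (Algebra.subset_adjoin ⟨b, hb, rfl⟩)
    · -- additivity in the numerator: `(y + z)/u = (y + z) · (1/u) = y/u + z/u`
      rw [IsLocalization.mk'_eq_mul_mk'_one, map_add, add_mul,
        ← IsLocalization.mk'_eq_mul_mk'_one, ← IsLocalization.mk'_eq_mul_mk'_one]
      exact Subalgebra.add_mem _ hy hz

-- `ht : t ∈ I` belongs to the registered signature (it is what makes `A[I/t]` a chart of the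
-- blow-up of `Spec A` along `I`) but is logically idle for the membership, whence the option.
set_option linter.unusedVariables false in
/-- **The coefficients of the strict transform lie in the affine blow-up algebra** (idea card
`transversal-strict-transform`, crux `TeissierReduction`): if the coefficients `aᵢ`, `i < n`, of
a monic degree-`n` polynomial in `z` over `A` satisfy the equimultiplicity condition
`aᵢ ∈ I^{n-i}` along `V(I)`, and `t ∈ I`, then each `aᵢ / t^{n-i} ∈ A[1/t]` lies in the affine
blow-up algebra `A[I/t] = A[b/t : b ∈ I]`; these are the coefficients of the monic equation of
`z/t` over `A[I/t]`. (The hypothesis `t ∈ I` is what makes `A[I/t]` a chart of the blow-up of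
`Spec A` along `I`; the membership itself holds for every `t`.) [folklore] -/
theorem stub_strictTransformIntegral (A : Type) [CommRing A] (I : Ideal A) (t : A) (ht : t ∈ I)
    (n : ℕ) (a : Fin n → A) (ha : ∀ i : Fin n, a i ∈ I ^ (n - i)) (i : Fin n) :
    IsLocalization.mk' (Localization.Away t) (a i)
        ⟨t ^ (n - i), Submonoid.pow_mem _ (Submonoid.mem_powers t) _⟩ ∈
      Algebra.adjoin A
        {y : Localization.Away t | ∃ b ∈ I, y = IsLocalization.mk' (Localization.Away t) b
          ⟨t, Submonoid.mem_powers t⟩} :=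
  mk'_mem_adjoin_of_mem_pow A I t (n - i) (a i) (ha i)

end

end Summit.ResolutionOfSingularities.ResolutionOfSingularities.Theorems.TeissierReduction
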